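import Literature.Analysis.FluidPDE.OseenDuhamelWeakStokes
import Literature.Analysis.FluidPDE.BoundedRepresentative
import Literature.Analysis.FluidPDE.SolenoidalL2Duality
import HarnessLib

/-!
# KNSS 2009, Lemma 3.1 in drift-mild form from its homogeneous case

Analysis/FluidPDE facts file on the discharge path of the named fact
`Literature.Analysis.FluidPDE.KNSS2009_weak_driftMild` (`KNSSRegularityDecomposition.lean`;
Koch–Nadirashvili–Seregin–Šverák, Acta Math. 203 (2009) = arXiv:0709.3599v1, §3 Lemma 3.1 with
§4 (ii), p. 8: a bounded weak Navier–Stokes solution is `u = v + w + b(t)`, `v` the mild solution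
of the linear Stokes problem with `f_k = −u_k u`, `w` caloric, `b` a bounded measurable function of
time). The printed proof of Lemma 3.1 begins: "In view of estimates (3.10) it is enough to
consider only the case `f = 0`" (arXiv p. 7) — i.e. the lemma for a general right-hand side
`∂ₖfₖ` is the lemma for the **homogeneous** Stokes system applied to `u − v`, `v` the mild
solution (3.3), which is itself a bounded weak solution. This file performs exactly that
reduction in the tree's rendering:

* `KNSS2009_lemma31_homogeneous` — **named fact**, Lemma 3.1 with `f = 0` on a finite-dimensional
  real inner product space `E` (KNSS: `ℝⁿ`): a bounded (`‖z‖ ≤ Z`), jointly a.e. strongly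
  measurable field `z` on `(0, T) × E` with weakly divergence-free slices for a.e. `t` and
  `∫₀ᵀ∫ ⟪z, ∂ₜψ + Δψ⟫ = 0` for all smooth compactly supported divergence-free `ψ` on the slab is
  `z(t) = w(t) + b(t)` a.e. in `x` for a.e. `t`, with `w` caloric (`w(t) = e^{(t−s)Δ}w(s)`,
  `0 < s < t < T`), `b` measurable, and `‖w‖, ‖b‖ ≤ C(T) Z` ((3.17)–(3.18)). Its discharge
  (by duality: `KNSSLemma31Caloric.lean` and sequel) is the remaining analytic content of
  `KNSS2009_weak_driftMild`.
* `IsBoundedWeakNSSolutionOn.exists_measurable_representative` — a bounded weak solution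
  bounded by `M` on its window has a jointly Borel measurable representative bounded by `M`
  everywhere, equal to it a.e. on a.e. slice, which is again a bounded weak solution (the class
  is one of `L^∞` functions, KNSS §3 p. 7 "a bounded measurable vector field"; radial retraction
  of a strongly measurable representative, as in `BoundedRepresentative.lean`).
* `KNSS2009_weak_driftMild_of_lemma31_homogeneous` — **the reduction, proved**:
  `KNSS2009_lemma31_homogeneous (E := ℝ³) → KNSS2009_weak_driftMild`. For a bounded weak solution
  `u` (jointly measurable representative), `z = u + ∫₀ᵗ 𝒩_{t−σ}(u ⊗ u) dσ` (`= u − v`) is a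
  bounded weak solution of the homogeneous Stokes system with weakly divergence-free slices
  (`OseenDuhamelWeakStokes.lean`); the homogeneous lemma gives `z = w + b`; then
  `U := w − ∫₀ᵗ 𝒩_{t−σ}(u ⊗ u) dσ` (`= v + w`) and `b` form a drift-mild pair
  (`IsKNSSDriftMild T N U b`, `N = C(T)Z + 70632 M² T^{1/2}`, `Z = M + 70632 M² T^{1/2}`): the
  drift-mild identity is the caloric law of `w` plus the restart identity of the Duhamel integral
  (`integral_sum_oseenHeat_duhamel_eq_heatExtension_add`), with `u ⊗ u` replaced by
  `(U + b) ⊗ (U + b)` since `u = U + b` a.e. (`integral_sum_oseenHeat_duhamel_congr_ae`).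

## Rendering of "`w` satisfies the heat equation"

As in `IsKNSSDriftMild.mild`, a bounded solution of `w_t − Δw = 0` in `ℝⁿ × (0, T)` is rendered by
the semigroup identity `w(t) = e^{(t−s)Δ}w(s)` for `0 < s < t < T` (pointwise; both sides are
continuous): for bounded `w` the two are equivalent (uniqueness of bounded distributional
solutions of the Cauchy problem for the heat equation), and the semigroup form is the one in
which KNSS use the decomposition (§4: `∇ᵏₓ(w + b)` bounded on `(δ, T)` "by Proposition 4.1",
i.e. by the smoothing of `e^{tΔ}`).

## Mathlib / tree search

Tree (`lean search 'IsBoundedWeakNSSolutionOn|driftDuhamel|heatExtension_(add|sub|const)|IsWeaklyDivFree\.'`):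
`IsBoundedWeakNSSolutionOn` and its projections (`KNSSLiouville`), the radial retraction
(`continuous_radialRetract`, `norm_radialRetract_le`, `radialRetract_eq_self`,
`BoundedRepresentative`), `IsBoundedWeakNSSolutionOn.integral_inner_add_driftDuhamel_heatAdjoint_eq_zero`,
`….ae_isWeaklyDivFree_add_driftDuhamel`, `norm_driftDuhamel_zero_le`,
`aestronglyMeasurable_uncurry_driftDuhamel_zero` (`OseenDuhamelWeakStokes`), the Duhamel calculus
(`OseenDuhamelMeasurable`: restart, a.e.-congruence, continuity), `IsWeaklyDivFree.congr_ae`,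
`IsWeaklyDivFree.sub_of_locallyIntegrable` (`SolenoidalL2Duality`),
`VectorCalculus.IsDivFree.isWeaklyDivFree_holds`, the heat toolkit (`HeatKernel`:
`convolutionExistsAt_of_memLp`, `memLp_heatKernel`). No prior representative lemma for the KNSS
class and no statement of Lemma 3.1 (`lean search 'lemma31|Lemma 3\.1' --decl`: only
`KNSSLemma31Caloric`'s constancy theorem). Mathlib: `Measure.ae_ae_of_ae_prod`,
`Measure.prod_restrict`, `ContinuousOn.measurable_piecewise`, `ConvolutionExistsAt.distrib_add`.

## References

* G. Koch, N. Nadirashvili, G. Seregin, V. Šverák, *Liouville theorems for the Navier–Stokes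
  equations and applications*, Acta Math. 203 (2009) 83–105 = arXiv:0709.3599v1: §3 Lemma 3.1
  with (3.17)–(3.18) and its proof (first sentence), Remark 3.1 (p. 7); §4 (ii) and the closing
  paragraph (p. 8); §1 p. 3 (parasitic solutions). [KochNadirashviliSereginSverak2009]
-/

noncomputable section

open MeasureTheory Set Function Filter TopologicalSpace InnerProductSpace
open scoped RealInnerProductSpace Laplacian ContDiff ENNReal

namespace Literature.Analysis.FluidPDE

/-! ### The homogeneous case of Lemma 3.1, as a named fact -/

section Fact

variable {E : Type*} [NormedAddCommGroup E] [InnerProductSpace ℝ E] [FiniteDimensional ℝ E]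
  [MeasurableSpace E] [BorelSpace E]

variable (E) in
/-- **KNSS 2009, Lemma 3.1, homogeneous case `f = 0`** (Acta Math. 203 (2009) =
arXiv:0709.3599v1, §3 p. 7: "let `u ∈ L^∞_{x,t}(ℝⁿ × (0,T))` be any weak solution of (3.1) in
`ℝⁿ × (0,T)` [with `f = 0`, so that the mild solution `v` of (3.1)–(3.2) with `u₀ = 0` vanishes].
Then `u(x,t) = w(x,t) + b(t)`, where `w` satisfies the heat equation `w_t − Δw = 0` in
`ℝⁿ × (0,T)` and `b` is a bounded measurable `ℝⁿ`-valued function on `(0,T)`. Moreover,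
`‖w‖_{L^∞(ℝⁿ×(0,T))} ≤ C(T)‖u‖_{L^∞(ℝⁿ×(0,T))}` (3.17) and `‖b‖_{L^∞(0,T)} ≤ C(T)‖u‖_{L^∞(ℝⁿ×(0,T))}`
(3.18)"; weak solutions of (3.1) with `f = 0`: "a bounded measurable vector field `u` is a weak
solution if `div u = 0` in `ℝⁿ × (0,T)` (in the sense of distributions) and
`∫₀ᵀ∫ u(φ_t + Δφ) dx dt = 0` for each `φ ∈ 𝒱_T`"). **Statement** on a finite-dimensional real
inner product space `E` (`= ℝⁿ`) with Lebesgue measure, for fields `z : ℝ → E → E` (time first):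
for every `T > 0` there is `C` such that for every `Z` and every `z` which is jointly a.e. strongly
measurable on `(0, T) × E`, bounded by `Z` there, weakly divergence free on a.e. slice, and
satisfies `∫_{(0,T)} ∫ ⟪z, ∂ₜψ + Δψ⟫ dx dt = 0` for all smooth compactly supported `ψ` on the open
slab with divergence-free slices, there are `w : ℝ → E → E` jointly measurable and `b : ℝ → E`
measurable with `w(t) = e^{(t−s)Δ}w(s)` pointwise for `0 < s < t < T` (the heat equation in
semigroup form, see the module docstring), `‖w(t, x)‖ ≤ C Z` on `(0, T) × E`, `‖b(t)‖ ≤ C Z`, and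
`z(t, ·) = w(t, ·) + b(t)` a.e. for a.e. `t ∈ (0, T)` (an identity in `L^∞(ℝⁿ × (0,T))`). By
Remark 3.1, `w` and `b` are determined up to a constant. [cite: KochNadirashviliSereginSverak2009, Lemma 3.1 (case f = 0) with (3.17)–(3.18), Remark 3.1 (arXiv:0709.3599v1 p. 7)] -/
def KNSS2009_lemma31_homogeneous : Prop :=
  ∀ T : ℝ, 0 < T → ∃ C : ℝ, ∀ (Z : ℝ) (z : ℝ → E → E),
    AEStronglyMeasurable (uncurry z) ((volume.restrict (Ioo 0 T)).prod (volume : Measure E)) →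
    (∀ t ∈ Ioo 0 T, ∀ x, ‖z t x‖ ≤ Z) →
    (∀ᵐ t ∂((volume : Measure ℝ).restrict (Ioo 0 T)), IsWeaklyDivFree (z t)) →
    (∀ ψ : ℝ → E → E, IsSpaceTimeTestOn (slab E (Ioo 0 T) isOpen_Ioo) ψ →
      (∀ t, VectorCalculus.IsDivFree (ψ t)) →
      ∫ t in Ioo 0 T, ∫ x, ⟪z t x, timeDeriv ψ t x + Δ (ψ t) x⟫ = 0) →
    ∃ (w : ℝ → E → E) (b : ℝ → E),
      Measurable (uncurry w) ∧
      (∀ s t : ℝ, 0 < s → s < t → t < T → ∀ x,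
        w t x = UnboundedOperators.heatExtension (w s) (t - s) x) ∧
      (∀ t ∈ Ioo 0 T, ∀ x, ‖w t x‖ ≤ C * Z) ∧
      Measurable b ∧ (∀ t, ‖b t‖ ≤ C * Z) ∧
      ∀ᵐ t ∂((volume : Measure ℝ).restrict (Ioo 0 T)), z t =ᵐ[volume] fun x => w t x + b t

end Fact

/-! ### Jointly measurable bounded representatives of bounded weak solutions -/

section Representative

variable {E : Type*} [NormedAddCommGroup E] [InnerProductSpace ℝ E] [FiniteDimensional ℝ E]
  [MeasurableSpace E] [BorelSpace E]

/-- **Bounded weak solutions have jointly Borel measurable bounded representatives.** If `u` is a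
bounded weak solution on the open time set `I` (`IsBoundedWeakNSSolutionOn`) with `‖u(t, x)‖ ≤ M`
for `t ∈ I` (`0 < M`), then there is `u'` with `uncurry u'` Borel measurable, `‖u'(t, x)‖ ≤ M` for
*all* `(t, x)`, `u'(t, ·) = u(t, ·)` a.e. for a.e. `t ∈ I`, which is again a bounded weak solution
on `I` (KNSS's class consists of `L^∞` functions, i.e. of a.e.-classes on the slab; every clause
of the definition is invariant under modification on a null set of the slab). Construction: the
radial retraction onto the ball of radius `M` of a strongly measurable representative of
`uncurry u` on the slab. [cite: KochNadirashviliSereginSverak2009, §3 p. 7 and §4 (ii) p. 8 (arXiv:0709.3599v1)] -/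
theorem IsBoundedWeakNSSolutionOn.exists_measurable_representative {I : Set ℝ} {hI : IsOpen I}
    {ν : ℝ} {u : ℝ → E → E} (h : IsBoundedWeakNSSolutionOn I hI ν u) {M : ℝ} (hM0 : 0 < M)
    (hM : ∀ t ∈ I, ∀ x, ‖u t x‖ ≤ M) :
    ∃ u' : ℝ → E → E, Measurable (uncurry u') ∧ (∀ t x, ‖u' t x‖ ≤ M) ∧
      (∀ᵐ t ∂((volume : Measure ℝ).restrict I), u' t =ᵐ[volume] u t) ∧
      IsBoundedWeakNSSolutionOn I hI ν u' := by
  obtain ⟨hmeas, -, hdiv, hweak⟩ := h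
  set μ : Measure (ℝ × E) := (volume : Measure (ℝ × E)).restrict (I ×ˢ univ) with hμ_def
  have hμ : μ = ((volume : Measure ℝ).restrict I).prod (volume : Measure E) := by
    rw [hμ_def, Measure.volume_eq_prod, ← Measure.prod_restrict, Measure.restrict_univ]
  set g : ℝ × E → E := hmeas.mk (uncurry u) with hg_def
  have hg : StronglyMeasurable g := hmeas.stronglyMeasurable_mk
  have hug : uncurry u =ᵐ[μ] g := hmeas.ae_eq_mk
  set ρ : E → E := fun v => (M / max M ‖v‖) • v with hρ_def
  have hρc : Continuous ρ := continuous_radialRetract hM0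
  set u' : ℝ → E → E := fun t x => ρ (g (t, x)) with hu'_def
  have hu'm : Measurable (uncurry u') := by
    have e : uncurry u' = ρ ∘ g := by
      funext p
      rfl
    rw [e]
    exact hρc.measurable.comp hg.measurable
  have hu'M : ∀ t x, ‖u' t x‖ ≤ M := fun t x => norm_radialRetract_le hM0 _
  -- `u' = u` a.e. on the slab, hence on a.e. slice
  have hae : ∀ᵐ p ∂μ, u' p.1 p.2 = u p.1 p.2 := by
    have hmem : ∀ᵐ p ∂μ, p ∈ I ×ˢ (univ : Set E) :=
      ae_restrict_mem (hI.measurableSet.prod MeasurableSet.univ)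
    filter_upwards [hug, hmem] with p hp hpm
    have hp' : g p = u p.1 p.2 := hp.symm
    show ρ (g (p.1, p.2)) = u p.1 p.2
    rw [Prod.mk.eta, hp']
    exact radialRetract_eq_self hM0 (hM p.1 (mem_prod.1 hpm).1 p.2)
  have hslice : ∀ᵐ t ∂((volume : Measure ℝ).restrict I), u' t =ᵐ[volume] u t := by
    rw [hμ] at hae
    exact (Measure.ae_ae_of_ae_prod hae).mono fun t ht => ht
  refine ⟨u', hu'm, hu'M, hslice, hu'm.aestronglyMeasurable, ⟨M, fun t _ x => hu'M t x⟩, ?_,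
    fun ψ hψ hψd => ?_⟩
  · filter_upwards [hdiv, hslice] with t ht hts
    exact ht.congr_ae hts.symm
  · rw [← hweak ψ hψ hψd]
    refine setIntegral_congr_ae hI.measurableSet ?_
    filter_upwards [(ae_restrict_iff' hI.measurableSet).1 hslice] with t ht hmem
    refine integral_congr_ae ?_
    filter_upwards [ht hmem] with x hx
    simp only [convect_apply, hx]

end Representative

/-! ### The reduction of Lemma 3.1 in drift-mild form to the homogeneous case -/

section Reduction

variable {E : Type*} [NormedAddCommGroup E] [InnerProductSpace ℝ E] [FiniteDimensional ℝ E]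
  [MeasurableSpace E] [BorelSpace E]

/-- Additivity of the caloric extension on `L^∞` data, pointwise (both convolution integrals
converge absolutely). The `Lᵖ` statement is `heatExtension_add_eq_of_memLp` of
`MildL3Restart.lean`, not imported here. [folklore] -/
private theorem heatExtension_add_of_memLp_top {f g : E → E} (hf : MemLp f ∞ volume)
    (hg : MemLp g ∞ volume) {a : ℝ} (ha : 0 < a) (x : E) :
    UnboundedOperators.heatExtension (fun y => f y + g y) a x =
      UnboundedOperators.heatExtension f a x + UnboundedOperators.heatExtension g a x := by
  haveI : (∞ : ℝ≥0∞).HolderConjugate 1 := ENNReal.HolderConjugate.top_one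
  have hK := UnboundedOperators.memLp_heatKernel (E := E) ha (le_refl (1 : ℝ≥0∞))
  exact ConvolutionExistsAt.distrib_add
    (UnboundedOperators.convolutionExistsAt_of_memLp (ContinuousLinearMap.lsmul ℝ ℝ) hK hf x)
    (UnboundedOperators.convolutionExistsAt_of_memLp (ContinuousLinearMap.lsmul ℝ ℝ) hK hg x)

/-- Subtraction form of `heatExtension_add_of_memLp_top`. [folklore] -/
private theorem heatExtension_sub_of_memLp_top {f g : E → E} (hf : MemLp f ∞ volume)
    (hg : MemLp g ∞ volume) {a : ℝ} (ha : 0 < a) (x : E) :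
    UnboundedOperators.heatExtension (fun y => f y - g y) a x =
      UnboundedOperators.heatExtension f a x - UnboundedOperators.heatExtension g a x := by
  have h := heatExtension_add_of_memLp_top (hf.sub hg) hg ha x
  have e : (fun y => (f - g) y + g y) = f := by
    funext y
    simp
  rw [e] at h
  have e2 : (fun y => f y - g y) = f - g := rfl
  rw [e2, h, add_sub_cancel_right]

/-- A constant field is weakly divergence free (it is `C¹` with `div = 0`). [folklore] -/
theorem isWeaklyDivFree_const (c : E) : IsWeaklyDivFree (fun _ : E => c) :=
  VectorCalculus.IsDivFree.isWeaklyDivFree_holds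
    (fun x => by simp [VectorCalculus.divergence]) contDiff_const

/-- **KNSS 2009, Lemma 3.1 in drift-mild form, from the homogeneous case** (arXiv:0709.3599v1,
proof of Lemma 3.1, first sentence: "In view of estimates (3.10) it is enough to consider only
the case `f = 0`"; §4 p. 8: "Let `v` be the mild solution of the linear Cauchy problem (3.1) and
(3.2) with `f_k = −u_k u` and `u₀ = 0`. By Lemma 3.1 we can write `u = v + w + b`"). Given the
homogeneous Lemma 3.1 on `ℝ³` (`KNSS2009_lemma31_homogeneous`), every bounded weak Navier–Stokes
solution `u` on `ℝ³ × (0, T)` with `‖u‖ ≤ M` is `U + b(t)` a.e. with `(U, b)` drift-mild with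
bound `N = N(M, T)` (`KNSS2009_weak_driftMild`): pass to a jointly measurable representative,
subtract the Duhamel velocity `−v = ∫₀ᵗ 𝒩_{t−σ}(u ⊗ u) dσ` to get a bounded weak solution
`z = u − v` of the homogeneous Stokes system (`OseenDuhamelWeakStokes.lean`), decompose
`z = w + b`, and set `U = v + w`; the drift-mild identity for `U` is the caloric law of `w` plus
the restart identity of the Duhamel integral, in which `u ⊗ u = (U + b) ⊗ (U + b)` a.e. [cite: KochNadirashviliSereginSverak2009, Lemma 3.1 (proof, first sentence) and §4 (ii) p. 8 (arXiv:0709.3599v1)] -/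
theorem KNSS2009_weak_driftMild_of_lemma31_homogeneous
    (h31 : KNSS2009_lemma31_homogeneous (EuclideanSpace ℝ (Fin 3))) :
    KNSS2009_weak_driftMild := by
  have hE : Module.finrank ℝ (EuclideanSpace ℝ (Fin 3)) = 3 := by simp
  intro M T hT
  obtain ⟨C, hC⟩ := h31 T hT
  -- constants
  set M₁ : ℝ := max M 1 with hM₁_def
  have hM₁ : 0 < M₁ := lt_of_lt_of_le one_pos (le_max_right _ _)
  set K : ℝ := 70632 * M₁ ^ 2 * T ^ (1 / 2 : ℝ) with hK_def
  have hK0 : 0 ≤ K := by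
    rw [hK_def]
    have := Real.rpow_nonneg hT.le (1 / 2 : ℝ)
    positivity
  set Z : ℝ := M₁ + K with hZ_def
  set N : ℝ := max (C * Z) 0 + K with hN_def
  refine ⟨N, fun u hu hM => ?_⟩
  -- a jointly measurable representative bounded by `M₁` everywhere
  obtain ⟨u', hu'm, hu'M, hslice, hu'⟩ := hu.exists_measurable_representative hM₁
    (fun t ht x => (hM t ht x).trans (le_max_left _ _))
  -- the Duhamel velocity `D = −v` and `z = u' + D`
  set D : ℝ → EuclideanSpace ℝ (Fin 3) → EuclideanSpace ℝ (Fin 3) :=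
    fun t x => driftDuhamel u' (fun _ => (0 : EuclideanSpace ℝ (Fin 3))) 0 t x with hD_def
  have hFm : ∀ j k, Measurable fun q : ℝ × EuclideanSpace ℝ (Fin 3) =>
      driftTensor u' (fun _ => (0 : EuclideanSpace ℝ (Fin 3))) q.1 j k q.2 :=
    measurable_driftTensor hu'm measurable_const
  have hFB : ∀ σ : ℝ, ∀ j k y,
      |driftTensor u' (fun _ => (0 : EuclideanSpace ℝ (Fin 3))) σ j k y| ≤ 4 * M₁ ^ 2 :=
    fun σ j k y => abs_driftTensor_zero_le hu'M σ j k y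
  have hB0 : (0 : ℝ) ≤ 4 * M₁ ^ 2 := by positivity
  have hDM : ∀ t ∈ Icc (0 : ℝ) T, ∀ x, ‖D t x‖ ≤ K := fun t ht x =>
    norm_driftDuhamel_zero_le hE hu'm hu'M ht x
  have hDcont : ContinuousOn (uncurry D) (Icc 0 T ×ˢ univ) := by
    have hc := continuousOn_integral_sum_oseenHeat_duhamel_prod hE hFm hB0 (s := 0) (T := T)
      (fun σ _ => hFB σ)
    refine hc.congr fun q _ => ?_
    simp [hD_def, uncurry, driftDuhamel_apply]
  have hDsl : ∀ t, 0 ≤ t → Continuous (D t) := fun t ht =>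
    continuous_integral_sum_oseenHeat_duhamel hE hFm hB0 ht (fun σ _ => hFB σ)
  -- the homogeneous lemma applied to `z = u' + D`
  have hzm : AEStronglyMeasurable (uncurry fun t x => u' t x + D t x)
      ((volume.restrict (Ioo 0 T)).prod (volume : Measure (EuclideanSpace ℝ (Fin 3)))) := by
    have h1 : AEStronglyMeasurable (uncurry u')
        ((volume.restrict (Ioo 0 T)).prod (volume : Measure (EuclideanSpace ℝ (Fin 3)))) :=
      hu'm.aestronglyMeasurable
    have h2 : AEStronglyMeasurable (uncurry D)
        ((volume.restrict (Ioo 0 T)).prod (volume : Measure (EuclideanSpace ℝ (Fin 3)))) :=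
      (aestronglyMeasurable_uncurry_driftDuhamel_zero hE hu'm hu'M le_rfl).mono_measure
        (Measure.prod_mono (Measure.restrict_mono Ioo_subset_Ioc_self le_rfl) le_rfl)
    exact h1.add h2
  have hzZ : ∀ t ∈ Ioo (0 : ℝ) T, ∀ x, ‖u' t x + D t x‖ ≤ Z := fun t ht x =>
    (norm_add_le _ _).trans (add_le_add (hu'M t x) (hDM t ⟨ht.1.le, ht.2.le⟩ x))
  have hzdiv := hu'.ae_isWeaklyDivFree_add_driftDuhamel hE hu'm hu'M
  have hzweak : ∀ ψ : ℝ → EuclideanSpace ℝ (Fin 3) → EuclideanSpace ℝ (Fin 3),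
      IsSpaceTimeTestOn (slab (EuclideanSpace ℝ (Fin 3)) (Ioo 0 T) isOpen_Ioo) ψ →
      (∀ t, VectorCalculus.IsDivFree (ψ t)) →
      ∫ t in Ioo 0 T, ∫ x, ⟪u' t x + D t x, timeDeriv ψ t x + Δ (ψ t) x⟫ = 0 :=
    fun ψ hψ hdiv => hu'.integral_inner_add_driftDuhamel_heatAdjoint_eq_zero hE hu'm hu'M hT hψ hdiv
  obtain ⟨w, b, hwm, hwcal, hwZ, hbm, hbZ, hzae⟩ :=
    hC Z (fun t x => u' t x + D t x) hzm hzZ hzdiv hzweak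
  -- `U = w − D`, with `D` extended by `0` off `[0, T] × E` for measurability
  set D' : ℝ × EuclideanSpace ℝ (Fin 3) → EuclideanSpace ℝ (Fin 3) :=
    (Icc (0 : ℝ) T ×ˢ (univ : Set (EuclideanSpace ℝ (Fin 3)))).piecewise (uncurry D) 0 with hD'_def
  have hD'm : Measurable D' :=
    ContinuousOn.measurable_piecewise hDcont continuousOn_const
      (measurableSet_Icc.prod MeasurableSet.univ)
  have hD'eq : ∀ t ∈ Icc (0 : ℝ) T, ∀ x, D' (t, x) = D t x := fun t ht x => by
    rw [hD'_def, piecewise_eq_of_mem _ _ _ (mem_prod.2 ⟨ht, mem_univ _⟩)]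
    rfl
  set U : ℝ → EuclideanSpace ℝ (Fin 3) → EuclideanSpace ℝ (Fin 3) :=
    fun t x => w t x - D' (t, x) with hU_def
  have hUeq : ∀ t ∈ Icc (0 : ℝ) T, ∀ x, U t x = w t x - D t x := fun t ht x => by
    simp only [hU_def, hD'eq t ht x]
  have hUm : Measurable (uncurry U) := by
    have e : uncurry U = fun p => uncurry w p - D' p := by
      funext p
      rfl
    rw [e]
    exact hwm.sub hD'm
  -- `u' = U + b` a.e. on a.e. slice of the window
  have hmemT : ∀ᵐ t ∂((volume : Measure ℝ).restrict (Ioo 0 T)), t ∈ Ioo 0 T :=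
    ae_restrict_mem measurableSet_Ioo
  have hUae : ∀ᵐ t ∂((volume : Measure ℝ).restrict (Ioo 0 T)),
      ∀ᵐ x ∂(volume : Measure (EuclideanSpace ℝ (Fin 3))), u' t x = U t x + b t := by
    filter_upwards [hzae, hmemT] with t ht htm
    filter_upwards [ht] with x hx
    rw [hUeq t ⟨htm.1.le, htm.2.le⟩ x]
    have hx' : u' t x + D t x = w t x + b t := hx
    rw [eq_sub_of_add_eq hx']
    abel
  -- slices of `w`, `U` in `L^∞`
  have hwsl : ∀ s ∈ Ioo (0 : ℝ) T, MemLp (w s) ∞ volume := fun s hs =>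
    memLp_top_of_bound (hwm.comp (measurable_const.prodMk measurable_id)).aestronglyMeasurable
      (C * Z) (Eventually.of_forall (hwZ s hs))
  have hDmem : ∀ s ∈ Ioo (0 : ℝ) T, MemLp (D s) ∞ volume := fun s hs =>
    memLp_top_of_bound (hDsl s hs.1.le).aestronglyMeasurable K
      (Eventually.of_forall (hDM s ⟨hs.1.le, hs.2.le⟩))
  have hCZ : C * Z ≤ max (C * Z) 0 := le_max_left _ _
  refine ⟨U, b, { measurable_drift := hbm
                  norm_drift_le := fun t => (hbZ t).trans (hCZ.trans (le_add_of_nonneg_right hK0))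
                  measurable := hUm
                  norm_le := ?_
                  ae_isWeaklyDivFree := ?_
                  mild := ?_ }, ?_⟩
  · -- the bound `N`
    intro t ht x
    rw [hUeq t ⟨ht.1.le, ht.2.le⟩ x]
    calc ‖w t x - D t x‖ ≤ ‖w t x‖ + ‖D t x‖ := norm_sub_le _ _
      _ ≤ C * Z + K := add_le_add (hwZ t ht x) (hDM t ⟨ht.1.le, ht.2.le⟩ x)
      _ ≤ N := add_le_add hCZ le_rfl
  · -- weakly divergence-free slices
    filter_upwards [hu'.ae_isWeaklyDivFree, hUae] with t hdiv hae
    have h1 : IsWeaklyDivFree (u' t - fun _ => b t) :=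
      hdiv.sub_of_locallyIntegrable (isWeaklyDivFree_const (b t))
        ((memLp_top_of_bound (hu'm.comp (measurable_const.prodMk measurable_id)).aestronglyMeasurable
          M₁ (Eventually.of_forall (hu'M t))).locallyIntegrable le_top)
        ((memLp_top_const (b t)).locallyIntegrable le_top)
    refine h1.congr_ae ?_
    filter_upwards [hae] with x hx
    simp only [Pi.sub_apply, hx, add_sub_cancel_right]
  · -- the drift-mild identity
    intro s t hs hst htT x
    have hsT : s ∈ Ioo (0 : ℝ) T := ⟨hs, hst.trans htT⟩
    have htT' : t ∈ Ioo (0 : ℝ) T := ⟨hs.trans hst, htT⟩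
    have hts : 0 < t - s := sub_pos.2 hst
    -- restart of the Duhamel velocity
    have hrestart : D t x = UnboundedOperators.heatExtension (D s) (t - s) x +
        driftDuhamel u' (fun _ => (0 : EuclideanSpace ℝ (Fin 3))) s t x := by
      have hfun : D s = fun y => ∫ σ in (0 : ℝ)..s, ∑ i, oseenHeat (s - σ)
          (driftTensor u' (fun _ => (0 : EuclideanSpace ℝ (Fin 3))) σ) i y •
            stdOrthonormalBasis ℝ (EuclideanSpace ℝ (Fin 3)) i := rfl
      simp only [hD_def]
      rw [driftDuhamel_apply, driftDuhamel_apply]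
      exact integral_sum_oseenHeat_duhamel_eq_heatExtension_add hE hFm hB0 hs.le hst
        (fun σ _ => hFB σ) x
    -- the forcing only sees `u' = U + b` a.e.
    have hforce : driftDuhamel u' (fun _ => (0 : EuclideanSpace ℝ (Fin 3))) s t x =
        driftDuhamel U b s t x := by
      rw [driftDuhamel_apply, driftDuhamel_apply]
      refine integral_sum_oseenHeat_duhamel_congr_ae hst.le ?_ x
      have hsub : ∀ᵐ σ ∂((volume : Measure ℝ).restrict (Ioo s t)),
          ∀ᵐ y ∂(volume : Measure (EuclideanSpace ℝ (Fin 3))), u' σ y = U σ y + b σ :=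
        ae_restrict_of_ae_restrict_of_subset (Ioo_subset_Ioo hs.le htT.le) hUae
      filter_upwards [hsub] with σ hσ j k
      filter_upwards [hσ] with y hy
      simp only [driftTensor_apply, hy, add_zero]
    -- the caloric law of `w` and linearity of `e^{(t−s)Δ}`
    have hlin : UnboundedOperators.heatExtension (U s) (t - s) x =
        UnboundedOperators.heatExtension (w s) (t - s) x -
          UnboundedOperators.heatExtension (D s) (t - s) x := by
      have e : U s = fun y => w s y - D s y := funext fun y => hUeq s ⟨hs.le, hsT.2.le⟩ y
      rw [e]
      exact heatExtension_sub_of_memLp_top (hwsl s hsT) (hDmem s hsT) hts x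
    rw [hUeq t ⟨htT'.1.le, htT.le⟩ x, hwcal s t hs hst htT x, hrestart, hlin, ← hforce]
    abel
  · -- `u = U + b` a.e. on a.e. slice
    filter_upwards [hslice, hUae] with t h1 h2
    filter_upwards [h1, h2] with x hx1 hx2
    rw [← hx1, hx2]

end Reduction

end Literature.Analysis.FluidPDE

end
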